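import Summits.RiemannHypothesis.RiemannHypothesis.Theorems.HandoffDodgerTransform
import Summits.RiemannHypothesis.RiemannHypothesis.Theorems.HandoffDodgerLagrange
import HarnessLib

/-!
# HANDOFF — Lemma A1 of ATTEMPT-16 for COMPLEX node polynomials: the cut-off cosine polynomial's transform is `(sin bξ/(bξ))·P(ξ²)/Λ_K(ξ²)` for any `P ∈ ℂ[X]` with `P(0) = 1`, `deg P ≤ K`, and real coefficients `a_k` matching `P` at the lattice (rh-explicit, track «HANDOFF», seat prove-2 gen9, ATTEMPT-18 §3 (R-1))

HONEST FRAMING. Nothing here bears on the truth of RH. This is gen8's `HandoffDodgerTransformLagrange.weilMellin_cutoffCosPoly_eq_div`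
(Lemma A1 assembled, stated there for `P ∈ ℝ[X]`) with the polynomial allowed to have COMPLEX coefficients: in the kernel programme of
ATTEMPT-18 (D-2)/(D-3) the dodger polynomial is `P(u) = Π_{ρ ∈ zerosBetween 0 T}(1 − u/z_ρ²)^{m(ρ)} ∈ ℂ[X]` (real-VALUED on `ℝ` by the
symmetry `ρ ↦ 1 − ρ̄`, which is all the cut-off cosine polynomial needs: its coefficients `a_k` are real numbers), and proving `P ∈ ℝ[X]` as a
polynomial is an avoidable detour. The proof is gen8's, verbatim up to the coefficient field: `weilMellin_cutoffCosPoly` (HandoffDodgerTransform)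
composed with the Lagrange identity `eval_div_prod_eq_one_sub_sum` (HandoffDodgerLagrange, any field). The lattice nodes are written
`ν_k = ℓ_{k+1}²` with `ℓ_j = latticeFreq b j = πj/b`. No `sorry`, standard axioms, no definitions.

References: this track (ATTEMPT-16 §2 Lemma A1; ATTEMPT-18 §3 (R-1)). Folklore.
-/

set_option linter.dupNamespace false

noncomputable section

open Complex Polynomial Finset Literature.NumberTheory.LFunctions
open scoped Real

namespace Summit.RiemannHypothesis.RiemannHypothesis.Theorems.Handoff

/-- The squared lattice frequencies are non-zero (`b ≠ 0`). [folklore] -/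
theorem latticeFreq_sq_ne_zero {b : ℝ} (hb : b ≠ 0) (K : ℕ) (k : Fin K) :
    (((latticeFreq b (k.val + 1)) ^ 2 : ℝ) : ℂ) ≠ 0 := by
  simp only [latticeFreq, ne_eq, Complex.ofReal_eq_zero]
  have : (π * ((k.val + 1 : ℕ) : ℝ) / b) ≠ 0 := by positivity
  exact pow_ne_zero 2 this

/-- The squared lattice frequencies are distinct (`b > 0`). [folklore] -/
theorem latticeFreq_sq_injective {b : ℝ} (hb : 0 < b) (K : ℕ) :
    Function.Injective (fun k : Fin K => (((latticeFreq b (k.val + 1)) ^ 2 : ℝ) : ℂ)) := by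
  intro i j h
  simp only [latticeFreq, Complex.ofReal_inj] at h
  have hi : 0 ≤ π * ((i.val + 1 : ℕ) : ℝ) / b := by positivity
  have hj : 0 ≤ π * ((j.val + 1 : ℕ) : ℝ) / b := by positivity
  have h1 : π * ((i.val + 1 : ℕ) : ℝ) / b = π * ((j.val + 1 : ℕ) : ℝ) / b := (pow_left_inj₀ hi hj two_ne_zero).1 h
  have h2 : ((i.val + 1 : ℕ) : ℝ) = ((j.val + 1 : ℕ) : ℝ) := by
    have hπ : (π : ℝ) ≠ 0 := Real.pi_ne_zero
    field_simp at h1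
    linarith
  exact Fin.ext (by exact_mod_cast (Nat.succ_injective (by exact_mod_cast h2) : i.val = j.val))

/-- **ATTEMPT-16 Lemma A1 for `P ∈ ℂ[X]` (kernel).** Let `P ∈ ℂ[X]` with `P(0) = 1`, `deg P ≤ K`, `b > 0`, and let REAL coefficients
`a_{k+1}` satisfy `a_{k+1} = (−1)^k·P(ℓ_{k+1}²)/(2Π_{m≠k}(1 − ℓ_{k+1}²/ℓ_{m+1}²))` in `ℂ` (`k < K`). Then for `ξ ∉ {0, ±ℓ_1, …, ±ℓ_K}`:
`weilMellin (cutoffCosPoly b K a) (½ + iξ) = (sin bξ/(bξ))·P(ξ²)/Π_{k<K}(1 − ξ²/ℓ_{k+1}²)`.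
[this track, ATTEMPT-16 Lemma A1; ATTEMPT-18 (R-1)] -/
theorem weilMellin_cutoffCosPoly_eq_div_complex {b : ℝ} (hb : 0 < b) (K : ℕ) (P : ℂ[X]) (hP0 : P.eval 0 = 1)
    (hdeg : P.natDegree ≤ K) (a : ℕ → ℝ)
    (ha : ∀ k : Fin K, ((a (k.val + 1) : ℝ) : ℂ) =
      (-1) ^ k.val * P.eval (((latticeFreq b (k.val + 1)) ^ 2 : ℝ) : ℂ) /
        (2 * ∏ m ∈ univ.erase k, (1 - (((latticeFreq b (k.val + 1)) ^ 2 : ℝ) : ℂ) /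
          (((latticeFreq b (m.val + 1)) ^ 2 : ℝ) : ℂ))))
    {ξ : ℂ} (hξ : ξ ≠ 0)
    (hξ1 : ∀ k ∈ Finset.range K, ξ + latticeFreq b (k + 1) ≠ 0)
    (hξ2 : ∀ k ∈ Finset.range K, ξ - latticeFreq b (k + 1) ≠ 0) :
    weilMellin (cutoffCosPoly b K a) (1 / 2 + I * ξ) =
      Complex.sin (b * ξ) / (b * ξ) *
        (P.eval (ξ ^ 2) / ∏ k : Fin K, (1 - ξ ^ 2 / (((latticeFreq b (k.val + 1)) ^ 2 : ℝ) : ℂ))) := by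
  rw [weilMellin_cutoffCosPoly hb K a hξ hξ1 hξ2]
  congr 1
  set ν : Fin K → ℂ := fun k => (((latticeFreq b (k.val + 1)) ^ 2 : ℝ) : ℂ) with hν
  have hu : ∀ k : Fin K, ξ ^ 2 ≠ ν k := by
    intro k h
    have hk : k.val ∈ Finset.range K := Finset.mem_range.2 k.isLt
    have : (ξ + latticeFreq b (k.val + 1)) * (ξ - latticeFreq b (k.val + 1)) = 0 := by
      rw [← sq_sub_sq, h, hν]
      push_cast; ring
    rcases mul_eq_zero.1 this with h1 | h2
    · exact hξ1 k.val hk h1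
    · exact hξ2 k.val hk h2
  have hL := eval_div_prod_eq_one_sub_sum ν (latticeFreq_sq_injective hb K) (latticeFreq_sq_ne_zero hb.ne' K)
    P hP0 hdeg (ξ ^ 2) hu
  show 1 + 2 * ∑ k ∈ Finset.range K, (-1) ^ (k + 1) * (a (k + 1) : ℂ) * (ξ ^ 2 / (ξ ^ 2 - (latticeFreq b (k + 1) : ℂ) ^ 2)) =
    P.eval (ξ ^ 2) / ∏ k : Fin K, (1 - ξ ^ 2 / ν k)
  rw [hL, Finset.sum_range (fun k ↦ (-1) ^ (k + 1) * (a (k + 1) : ℂ) *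
    (ξ ^ 2 / (ξ ^ 2 - (latticeFreq b (k + 1) : ℂ) ^ 2))), sub_eq_add_neg, ← Finset.sum_neg_distrib, Finset.mul_sum]
  congr 1
  refine Finset.sum_congr rfl fun k _ ↦ ?_
  rw [ha k]
  have hprod : (∏ m ∈ univ.erase k, (1 - ν k / ν m)) ≠ 0 := by
    rw [Finset.prod_ne_zero_iff]
    intro m hm
    have hmk : m ≠ k := ne_of_mem_erase hm
    have : ν k / ν m ≠ 1 := by
      intro h
      rw [div_eq_one_iff_eq (latticeFreq_sq_ne_zero hb.ne' K m)] at h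
      exact hmk ((latticeFreq_sq_injective hb K) h).symm
    exact sub_ne_zero.2 (Ne.symm this)
  have huk := hu k
  simp only [hν] at hprod huk ⊢
  push_cast at hprod huk ⊢
  have hden : ξ ^ 2 - (latticeFreq b (k.val + 1) : ℂ) ^ 2 ≠ 0 := sub_ne_zero.2 huk
  rcases neg_one_pow_eq_or ℂ k.val with h | h
  · rw [pow_succ, h]
    field_simp
  · rw [pow_succ, h]
    field_simp

end Summit.RiemannHypothesis.RiemannHypothesis.Theorems.Handoff

end
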